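import Literature.Barriers.CriticalPhenomena.NoExactPlusRelationZ2
import Literature.Barriers.CriticalPhenomena.NoExactDominoRelationZ2
import Literature.Barriers.CriticalPhenomena.NoExactPlaquetteRelationZ2
import HarnessLib

/-!
# Barrier (SAWScalingLimit): the plus stencil contains the vertex star and the domino — zero-extension

Kernel cross-check of the slot conventions of the square-lattice stencil catalogue
(`NienhuisWeightsExcludeVertexSAW`, `NoExactDominoRelationZ2`, `NoExactPlusRelationZ2Instances`):
zero-extension of the coefficients embeds

* the one-vertex class `ExactVertexRelationZ2` (Duminil-Copin–Smirnov's Lemma 1 shape on `ℤ²`: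
  four coefficients on the four mid-edges at `v`) into the plus class as the slots `0–3`, and
* the domino class `ExactDominoRelationZ2` (seven coefficients on the mid-edges adjacent to the
  horizontal domino `{v, v + e₀}`) into the plus class as the slots `0, 1, 2, 3` (edges at `v`),
  `4` (at `v + e₀`, straight on), `8` (at `v + e₀`, left) and `12` (at `v + e₀`, right),

because a vertex whose sixteen plus mid-edges are domain edges is in particular an admissible vertex
star / an admissible domino. Consequently the plus no-go `exactPlusRelationZ2_eq_zero`
(`NoExactPlusRelationZ2.lean`) re-derives the domino and vertex no-gos at every real fugacity
`x ≠ 0` and every spin, stated here as the equivalences «relation ⟺ all coefficients vanish»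
(`exactVertexRelationZ2_iff_eq_zero`, `exactDominoRelationZ2_iff_eq_zero`,
`exactPlusRelationZ2_iff_eq_zero`). No enumeration and no certificate is used in this file.

## What the source prints

Duminil-Copin–Smirnov, Ann. of Math. 175 (2012), Lemma 1: "If `x = x_c` and `σ = 5/8`, then `F`
satisfies the following relation for every vertex `v ∈ V(Ω)`: `(p - v)F(p) + (q - v)F(q) + (r - v)F(r) = 0`"
— one vertex, constant coefficients. The three `ℤ²` classes compared here are that SHAPE on the
square lattice with 4, 7 and 16 free coefficients.
-/

noncomputable section

namespace Literature.Barriers.CriticalPhenomena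

open Literature.Probability.RandomPlanarGeometry.SAW Literature.Probability.LatticeModels
  Literature.Probability.Percolation

/-- **Zero-extension: a one-vertex relation is a plus relation** (slots `0–3` of the plus are the
four mid-edges at `v`). [cite: DuminilCopinSmirnov2012, Lemma 1 (shape of the relation, one vertex)] -/
theorem exactPlusRelationZ2_of_vertex {x σ : ℝ} {c : Fin 4 → ℂ} (h : ExactVertexRelationZ2 x σ c) :
    ExactPlusRelationZ2 x σ ![c 0, c 1, c 2, c 3, 0, 0, 0, 0, 0, 0, 0, 0, 0, 0, 0, 0] := by
  intro Ω δ a v hδ ha hw hadj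
  have hv := h Ω δ a v hδ ha hw (fun i => by
    fin_cases i
    · simpa [plusBase, plusDir] using hadj 0
    · simpa [plusBase, plusDir] using hadj 1
    · simpa [plusBase, plusDir] using hadj 2
    · simpa [plusBase, plusDir] using hadj 3)
  unfold plusFunctionalZ2
  rw [Fin.sum_univ_four] at hv
  simp only [Fin.sum_univ_succ, Fin.sum_univ_zero]
  simp only [plusBase, plusDir] at hv ⊢
  simp at hv ⊢
  linear_combination hv

/-- **Zero-extension: a domino relation is a plus relation** (the seven mid-edges adjacent to the
horizontal domino `{v, v + e₀}` are the plus slots `0, 1, 2, 3, 4, 8, 12`).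
[cite: DuminilCopinSmirnov2012, Lemma 1 (shape of the relation, one vertex)] -/
theorem exactPlusRelationZ2_of_domino {x σ : ℝ} {c : Fin 7 → ℂ} (h : ExactDominoRelationZ2 x σ c) :
    ExactPlusRelationZ2 x σ ![c 0, c 1, c 2, c 3, c 4, 0, 0, 0, c 5, 0, 0, 0, c 6, 0, 0, 0] := by
  intro Ω δ a v hδ ha hw hadj
  have hv := h Ω δ a v hδ ha hw (fun k => by
    fin_cases k
    · simpa [dominoBase, dominoDir, plusBase, plusDir] using hadj 0
    · simpa [dominoBase, dominoDir, plusBase, plusDir] using hadj 1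
    · simpa [dominoBase, dominoDir, plusBase, plusDir] using hadj 2
    · simpa [dominoBase, dominoDir, plusBase, plusDir] using hadj 3
    · simpa [dominoBase, dominoDir, plusBase, plusDir] using hadj 4
    · simpa [dominoBase, dominoDir, plusBase, plusDir] using hadj 8
    · simpa [dominoBase, dominoDir, plusBase, plusDir] using hadj 12)
  unfold plusFunctionalZ2
  unfold dominoFunctionalZ2 at hv
  rw [Fin.sum_univ_seven] at hv
  simp only [Fin.sum_univ_succ, Fin.sum_univ_zero]
  simp only [plusBase, plusDir, dominoBase, dominoDir] at hv ⊢
  simp at hv ⊢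
  linear_combination hv

/-- **The one-vertex relation class is trivial at every real fugacity `x ≠ 0` and every spin** —
re-derived from the plus no-go `exactPlusRelationZ2_eq_zero` by zero-extension (the direct proofs are
`exactVertexRelationZ2_eq_zero_of_ne_zero` and, for `0 < x < 1`, `exactVertexRelationZ2_eq_zero`).
[cite: DuminilCopinSmirnov2012, Lemma 1 (shape of the relation; square-lattice counterpart holds only with zero coefficients)] -/
theorem exactVertexRelationZ2_iff_eq_zero {x σ : ℝ} (hx : x ≠ 0) (c : Fin 4 → ℂ) :
    ExactVertexRelationZ2 x σ c ↔ c = 0 := by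
  constructor
  · intro h
    have h16 := exactPlusRelationZ2_eq_zero hx (exactPlusRelationZ2_of_vertex h)
    funext i
    fin_cases i
    · simpa using congrFun h16 0
    · simpa using congrFun h16 1
    · simpa using congrFun h16 2
    · simpa using congrFun h16 3
  · rintro rfl
    exact exactVertexRelationZ2_zero x σ

/-- **The domino relation class is trivial at every real fugacity `x ≠ 0` and every spin** —
re-derived from the plus no-go `exactPlusRelationZ2_eq_zero` by zero-extension (direct proof:
`exactDominoRelationZ2_eq_zero`).
[cite: DuminilCopinSmirnov2012, Lemma 1 (shape of the relation; two-vertex square-lattice counterpart holds only with zero coefficients)] -/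
theorem exactDominoRelationZ2_iff_eq_zero {x σ : ℝ} (hx : x ≠ 0) (c : Fin 7 → ℂ) :
    ExactDominoRelationZ2 x σ c ↔ c = 0 := by
  constructor
  · intro h
    have h16 := exactPlusRelationZ2_eq_zero hx (exactPlusRelationZ2_of_domino h)
    funext i
    fin_cases i
    · simpa using congrFun h16 0
    · simpa using congrFun h16 1
    · simpa using congrFun h16 2
    · simpa using congrFun h16 3
    · simpa using congrFun h16 4
    · simpa using congrFun h16 8
    · simpa using congrFun h16 12
  · rintro rfl
    exact exactDominoRelationZ2_zero x σ

/-- **The plus relation class is trivial at every real fugacity `x ≠ 0` and every spin**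
(`exactPlusRelationZ2_eq_zero` and `exactPlusRelationZ2_zero` as one equivalence).
[cite: DuminilCopinSmirnov2012, Lemma 1 (shape of the relation; sixteen-slot square-lattice counterpart holds only with zero coefficients)] -/
theorem exactPlusRelationZ2_iff_eq_zero {x σ : ℝ} (hx : x ≠ 0) (c : Fin 16 → ℂ) :
    ExactPlusRelationZ2 x σ c ↔ c = 0 :=
  ⟨exactPlusRelationZ2_eq_zero hx, by rintro rfl; exact exactPlusRelationZ2_zero x σ⟩

end Literature.Barriers.CriticalPhenomena

/-! ## Appendix F: the face (plaquette) is a sub-stencil of the plus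

The four edges of the unit square with lower-left corner `v` (`NoExactPlaquetteRelationZ2`:
`plaqCorner v i`, directions `e₀, e₁, -e₀, -e₁` counter-clockwise) are the plus slots `0` (at `v`,
direction `e₀`), `8` (at `v + e₀`, left turn), `13` (at `v + e₁`, right turn) and `1` (at `v`,
direction `e₁`), the last two traversed backwards (a mid-edge is unoriented). Hence an exact face
relation (Ikhlef–Cardy's discrete-holomorphicity shape) extends by zeros to a plus relation, and
the plus no-go re-derives the face no-go `exactPlaquetteRelationZ2_eq_zero` at every real `x ≠ 0`.
The twelve-slot block stencil of `NoExactBlockRelationZ2` is NOT a sub-stencil of one plus (its far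
corner `v + e₀ + e₁` is not a neighbour of `v`), so no such embedding is claimed for it. -/

namespace Literature.Barriers.CriticalPhenomena

open Literature.Probability.RandomPlanarGeometry.SAW Literature.Probability.LatticeModels
  Literature.Probability.Percolation

/-- The third corner step of the unit square returns to the left column: `v + e₀ + e₁ - e₀ = v + e₁`. [folklore] -/
private theorem plaq_corner_two (v : Site 2) : v + dirZ2 0 + dirZ2 1 + dirZ2 2 = v + dirZ2 1 := by
  funext j; fin_cases j <;> simp [dirZ2, Matrix.vecHead, Matrix.vecTail]

/-- The fourth corner step of the unit square returns to the base corner: `v + e₁ - e₁ = v`. [folklore] -/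
private theorem plaq_corner_three (v : Site 2) : v + dirZ2 1 + dirZ2 3 = v := by
  funext j; fin_cases j <;> simp [dirZ2, Matrix.vecHead, Matrix.vecTail]

/-- `v + e₁ + e₀ = v + e₀ + e₁`. [folklore] -/
private theorem plaq_corner_one (v : Site 2) : v + dirZ2 1 + dirZ2 0 = v + dirZ2 0 + dirZ2 1 := by
  rw [add_assoc, add_assoc, add_comm (dirZ2 1)]

/-- **Zero-extension: a face (plaquette) relation is a plus relation** (the four edges of the unit
square with lower-left corner `v` are the plus slots `0` (at `v`, direction `e₀`), `8` (at `v + e₀`,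
left), `13` (at `v + e₁`, right) and `1` (at `v`, direction `e₁`)).
[cite: IkhlefCardy2009, §1, eq. (1) (shape of the face relation)] -/
theorem exactPlusRelationZ2_of_plaquette {x σ : ℝ} {c : Fin 4 → ℂ} (h : ExactPlaquetteRelationZ2 x σ c) :
    ExactPlusRelationZ2 x σ ![c 0, c 3, 0, 0, 0, 0, 0, 0, c 1, 0, 0, 0, 0, c 2, 0, 0] := by
  intro Ω δ a v hδ ha hw hadj
  have hv := h Ω δ a v hδ ha hw (fun i => by
    fin_cases i
    · simpa [plaqCorner, plusBase, plusDir] using hadj 0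
    · simpa [plaqCorner, plusBase, plusDir] using hadj 8
    · have h13 := hadj 13
      simp [plusBase, plusDir] at h13
      simp [plaqCorner]
      rw [plaq_corner_two, ← plaq_corner_one]
      exact h13.symm
    · have h1 := hadj 1
      simp [plusBase, plusDir] at h1
      simp [plaqCorner]
      rw [plaq_corner_three]
      exact h1.symm)
  unfold plusFunctionalZ2
  unfold plaquetteFunctionalZ2 at hv
  rw [Fin.sum_univ_four] at hv
  simp only [Fin.sum_univ_succ, Fin.sum_univ_zero]
  simp [plusBase, plusDir, plaqCorner, plaq_corner_two, plaq_corner_three, plaq_corner_one] at hv ⊢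
  linear_combination hv

/-- **The face relation class is trivial at every real fugacity `x ≠ 0` and every spin** —
re-derived from the plus no-go `exactPlusRelationZ2_eq_zero` by zero-extension (direct proof:
`exactPlaquetteRelationZ2_eq_zero`; with `c = (1, i, -1, -i)` this is `not_discretelyHolomorphic_faces_Z2`).
[cite: IkhlefCardy2009, §1, eq. (1) (shape of the face relation; square-lattice SAW counterpart holds only with zero coefficients)] -/
theorem exactPlaquetteRelationZ2_iff_eq_zero {x σ : ℝ} (hx : x ≠ 0) (c : Fin 4 → ℂ) :
    ExactPlaquetteRelationZ2 x σ c ↔ c = 0 := by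
  constructor
  · intro h
    have h16 := exactPlusRelationZ2_eq_zero hx (exactPlusRelationZ2_of_plaquette h)
    funext i
    fin_cases i
    · simpa using congrFun h16 0
    · simpa using congrFun h16 8
    · simpa using congrFun h16 13
    · simpa using congrFun h16 1
  · rintro rfl
    exact exactPlaquetteRelationZ2_zero x σ

end Literature.Barriers.CriticalPhenomena
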